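import Summits.QuantumAdvantage.QuantumAdvantage.Theorems.CubicForrelationNearExactIsExactTwoModSixSecondLevels
import Summits.QuantumAdvantage.QuantumAdvantage.Theorems.CubicForrelationNearExactIsExactTwentySecondLevelTen
import Summits.QuantumAdvantage.QuantumAdvantage.Theorems.CubicForrelationNearExactIsExactTwoModSixSecondLevelTwoBalanced
import Summits.QuantumAdvantage.QuantumAdvantage.Theorems.CubicForrelationNearExactIsExactTwoModSixSecondTypeOLowRank

/-!
# Crux `CubicForrelation.NearExactIsExact` (stmt-QuantumAdvantage-14043) — `n = 6r+2` at the SECOND boundary `1 − 2^{−2r}`: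
  the STRUCTURE of a hypothetical cubic pair with `1 − 2^{−2r} ≤ Φ < 1` (`r ≥ 3`), uniform in `r`

Certificate seat `b2b-cforr-cert` (gen 9).  HONEST FRAMING: theorems about cubic Boolean pairs on `6r+2` bits — the certified residual case
list for "`Φ ≥ 1 − 2^{−2r} ⇒ Φ = 1`", assembled from the uniform branch kills `tm2_levelThree_false`, `tm2_levelFour_false`,
`tm2_second_high_levels` (`r ≥ 4`) / `tw20_levels_exact` (`r = 3`), `tm2_levelTwo_balanced_false` and `tm2_lowrank_false` — NOT a proof of
that implication, NOT summit progress.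

* `tm2_parity_const` — at the base level `W_g = 2^{2r+1}u` the parity of `u` is constant (T with `d = 0`).
* `tm2_levels_exact` — `W_g ∈ 2^{2r+3}ℤ` and `Φ ≥ 1 − 2^{−2r}` force `Φ = 1` (`r ≥ 3`).
* `tm2_levelTwo_card` — `W_g = 2^{2r+2}u'` with some `u'` odd and `Φ ≥ 1 − 2^{−2r}`: `2^{6r} ≤ #{u' odd} < 2^{6r+1}` (`r ≥ 2`).
* `tm2_second_structure` — if `1 − 2^{−2r} ≤ Φ(f,g) < 1` (`r ≥ 3`) then a side sits at level `2r+2` with an odd set of size in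
  `[2^{6r}, 2^{6r+1})`, or both spectra are of type O (`u` odd everywhere) and on each side the radical of the first digit `d₁ = [⌊u/2⌋ odd]`
  has `< 2^{6r}` elements (rank `d₁ ≥ 4`) or `d₁ = d₂` everywhere (for `r ≥ 3` the expensive digit class is `{d₁ ≠ d₂}`, cf. case A at
  `n = 14` where it is `{d₁ = d₂}`);  instances `second_boundary_structure_twenty` / `_twentysix`.

References: as in the imported files.  Everything below is proved from Mathlib and the tree; axioms are the standard three.
-/

set_option linter.dupNamespace false -- D-0017: single-problem summit ⇒ `QuantumAdvantage.QuantumAdvantage` by design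

noncomputable section

namespace Summit.QuantumAdvantage.QuantumAdvantage.Theorems.CubicForrelation.NearExactIsExact

open Finset
open Literature.Computability.QuantumComplexity
open Literature.Computability.QuantumComplexity.BuzetChailloux (bxor zeroVec)
open Literature.Computability.QuantumComplexity.DerivativeWalsh (W)
open Summit.QuantumAdvantage.QuantumAdvantage.Theorems.SignedCubicForrelationNotPrBPP.Negative.HalfQuad (forrelation_comm)

/-- **Constant parity at the base level.** For cubic `g` on `6r+2` bits with `W_g = 2^{2r+1}·u`, all values `u(x)` have the same parity
(T with `d = 0`). [folklore] -/
theorem tm2_parity_const (r : ℕ) (g : (Fin ((3 * r + 1) + (3 * r + 1)) → Bool) → Bool) (u : (Fin ((3 * r + 1) + (3 * r + 1)) → Bool) → ℤ)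
    (hg : IsDegLeFun 3 g) (hu : ∀ x, W (fun y => signOf (g y)) x = (2 : ℝ) ^ (2 * r + 1) * (u x : ℝ))
    (x x₀ : Fin ((3 * r + 1) + (3 * r + 1)) → Bool) : Odd (u x) ↔ Odd (u x₀) := by
  have h0 : IsDegLeFun 0 (fun x => decide (Odd (u x))) :=
    stub_walshTower stub_axParity ((3 * r + 1) + (3 * r + 1)) (2 * r + 1) 0 g u hg hu (by intro k hk hkn; omega)
  have h := tc_const_of_deg_zero h0 x x₀
  simpa only [decide_eq_decide] using h

/-- **Levels `≥ 2r+3` are exact at the second boundary (`r ≥ 3`).**  For cubic `f, g` on `6r+2` bits with `W_g = 2^{2r+3}·w` and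
`Φ(f,g) ≥ 1 − (1/2)^{2r}`: `Φ(f,g) = 1` (`tw20_levels_exact` at `r = 3`, `tm2_second_levels_exact` for `r ≥ 4`).  NOT summit progress.
[this work] -/
theorem tm2_levels_exact (r : ℕ) (hr : 3 ≤ r) (f g : (Fin ((3 * r + 1) + (3 * r + 1)) → Bool) → Bool) (hf : IsDegLeFun 3 f)
    (hg : IsDegLeFun 3 g) (w : (Fin ((3 * r + 1) + (3 * r + 1)) → Bool) → ℤ)
    (hw : ∀ x, W (fun y => signOf (g y)) x = (2 : ℝ) ^ (2 * r + 3) * (w x : ℝ))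
    (hΦ : 1 - (1 / 2 : ℝ) ^ (2 * r) ≤ forrelation f g) : forrelation f g = 1 := by
  rcases Nat.eq_or_lt_of_le hr with rfl | hr4
  · exact tw20_levels_exact f g hf hg w hw (by norm_num at hΦ; exact hΦ)
  · exact tm2_second_levels_exact r hr4 f g hf hg w hw hΦ

/-- **The level-`(2r+2)` window (`r ≥ 2`).** For cubic `f, g` on `6r+2` bits with `W_g = 2^{2r+2}·u'`, some `u'(x)` odd and
`Φ(f,g) ≥ 1 − (1/2)^{2r}`: `2^{6r} ≤ #{u' odd} < 2^{6r+1}` (Reed–Muller for the quadratic parity; the budget `Σ(u' − 2^{r−1}s)² ≤ 2^{6r+1}`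
with cost `≥ 1` per odd point; `tm2_levelTwo_balanced_false` excludes equality).  NOT summit progress. [this work] -/
theorem tm2_levelTwo_card (r : ℕ) (hr : 2 ≤ r) (f g : (Fin ((3 * r + 1) + (3 * r + 1)) → Bool) → Bool) (hf : IsDegLeFun 3 f)
    (hg : IsDegLeFun 3 g) (u' : (Fin ((3 * r + 1) + (3 * r + 1)) → Bool) → ℤ)
    (hu' : ∀ x, W (fun y => signOf (g y)) x = (2 : ℝ) ^ (2 * r + 2) * (u' x : ℝ))
    (hodd : ∃ x, Odd (u' x)) (hΦ : 1 - (1 / 2 : ℝ) ^ (2 * r) ≤ forrelation f g) :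
    2 ^ (6 * r) ≤ #(univ.filter fun x : Fin ((3 * r + 1) + (3 * r + 1)) → Bool => Odd (u' x)) ∧
      #(univ.filter fun x : Fin ((3 * r + 1) + (3 * r + 1)) → Bool => Odd (u' x)) < 2 ^ (6 * r + 1) := by
  classical
  have hne : #(univ.filter fun x : Fin ((3 * r + 1) + (3 * r + 1)) → Bool => Odd (u' x)) ≠ 2 ^ (6 * r + 1) :=
    fun h => tm2_levelTwo_balanced_false r hr f g hf hg u' hu' h hΦ
  obtain ⟨t, rfl⟩ : ∃ t, r = t + 2 := ⟨r - 2, by omega⟩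
  have hp : IsDegLeFun 2 (fun x => decide (Odd (u' x))) :=
    stub_walshTower stub_axParity ((3 * (t + 2) + 1) + (3 * (t + 2) + 1)) (2 * (t + 2) + 2) 2 g u' hg hu' (by intro k hk hkn; omega)
  obtain ⟨x₁, hx₁⟩ := hodd
  have hfilt : (univ.filter fun x : Fin ((3 * (t + 2) + 1) + (3 * (t + 2) + 1)) → Bool => decide (Odd (u' x)) = true) =
      univ.filter (fun x : Fin ((3 * (t + 2) + 1) + (3 * (t + 2) + 1)) → Bool => Odd (u' x)) := filter_congr fun x _ => by simp
  have hRM := bb_rmWeight_holds ((3 * (t + 2) + 1) + (3 * (t + 2) + 1)) 2 (fun x => decide (Odd (u' x))) hp ⟨x₁, by simpa using hx₁⟩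
  rw [hfilt] at hRM
  have hN : (2 : ℕ) ^ ((3 * (t + 2) + 1) + (3 * (t + 2) + 1)) = 2 ^ 2 * 2 ^ (6 * (t + 2)) := by ring
  refine ⟨by rw [hN] at hRM; exact Nat.le_of_mul_le_mul_left hRM (by positivity), ?_⟩
  -- the budget bounds the odd set by `2^{6r+1}`
  set u : (Fin ((3 * (t + 2) + 1) + (3 * (t + 2) + 1)) → Bool) → ℤ := fun x => 2 * u' x with hudef
  have hu5 : ∀ x, W (fun y => signOf (g y)) x = (2 : ℝ) ^ (2 * (t + 2) + 1) * (u x : ℝ) := by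
    intro x; rw [hu' x]; simp only [u]; push_cast; ring
  have hpow2 : (2 : ℤ) ^ (t + 2) = 2 * 2 ^ (t + 1) := by ring
  have h4 : ∀ x, (u x - 2 ^ (t + 2) * sZ (f x)) ^ 2 = 4 * (u' x - 2 ^ (t + 1) * sZ (f x)) ^ 2 := fun x => by
    simp only [u]; rw [hpow2]; ring
  have hbud := tms_budget (t + 2) f g u hu5
  have hpow : (2 : ℝ) ^ (8 * (t + 2) + 3) * (1 / 2) ^ (2 * (t + 2)) = 2 ^ (6 * t + 15) := by
    rw [one_div_pow]; field_simp; ring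
  have hB0 : (∑ x, (u x - 2 ^ (t + 2) * sZ (f x)) ^ 2 : ℤ) ≤ 2 ^ (6 * t + 15) := by
    have h1 : 1 - forrelation f g ≤ (1 / 2 : ℝ) ^ (2 * (t + 2)) := by linarith
    have h' : ((∑ x, (u x - 2 ^ (t + 2) * sZ (f x)) ^ 2 : ℤ) : ℝ) ≤ (2 : ℝ) ^ (6 * t + 15) := by
      rw [hbud, ← hpow]
      exact mul_le_mul_of_nonneg_left h1 (by positivity)
    exact_mod_cast h'
  have hB : (∑ x, (u' x - 2 ^ (t + 1) * sZ (f x)) ^ 2 : ℤ) ≤ 2 ^ (6 * t + 13) := by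
    have h'' := hB0
    rw [sum_congr rfl fun x _ => h4 x, ← mul_sum, show (2 : ℤ) ^ (6 * t + 15) = 4 * 2 ^ (6 * t + 13) by ring] at h''
    linarith
  have hsumP : (∑ x, (if Odd (u' x) then 1 else 0 : ℤ)) =
      #(univ.filter fun x : Fin ((3 * (t + 2) + 1) + (3 * (t + 2) + 1)) → Bool => Odd (u' x)) := by rw [sum_boole]
  have hpt : ∀ x, (if Odd (u' x) then 1 else 0 : ℤ) ≤ (u' x - 2 ^ (t + 1) * sZ (f x)) ^ 2 := by
    intro x
    by_cases h : Odd (u' x)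
    · rw [if_pos h]
      have hodd' : Odd (u' x - 2 ^ (t + 1) * sZ (f x)) :=
        Int.odd_sub.2 (iff_of_true h (by rw [pow_succ]; exact ⟨2 ^ t * sZ (f x), by ring⟩))
      have h0 := Int.odd_iff.1 hodd'
      have : u' x - 2 ^ (t + 1) * sZ (f x) ≤ -1 ∨ 1 ≤ u' x - 2 ^ (t + 1) * sZ (f x) := by omega
      have := tp_sq_ge (k := 1) (by norm_num) this
      linarith
    · rw [if_neg h]; exact sq_nonneg _
  have hle : (#(univ.filter fun x : Fin ((3 * (t + 2) + 1) + (3 * (t + 2) + 1)) → Bool => Odd (u' x)) : ℤ) ≤ 2 ^ (6 * t + 13) := by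
    rw [← hsumP]; exact (sum_le_sum fun x _ => hpt x).trans hB
  have hle' : #(univ.filter fun x : Fin ((3 * (t + 2) + 1) + (3 * (t + 2) + 1)) → Bool => Odd (u' x)) ≤ 2 ^ (6 * t + 13) := by
    exact_mod_cast hle
  have e13 : (2 : ℕ) ^ (6 * (t + 2) + 1) = 2 ^ (6 * t + 13) := by ring
  rw [e13] at hne ⊢
  omega

/-- **Structure at the second boundary on `6r+2` bits (`r ≥ 3`).**  If cubic `f, g : 𝔽₂^{(3r+1)+(3r+1)} → 𝔽₂` satisfy
`1 − (1/2)^{2r} ≤ Φ(f,g)` and `Φ(f,g) ≠ 1`, then:  `g` is at level `2r+2` with `2^{6r} ≤ #{W_g/2^{2r+2} odd} < 2^{6r+1}`;  or `f` is;  or both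
spectra are of type O (`W = 2^{2r+1}u`, `u` odd everywhere) and on each side the radical of the first digit `d₁ = [⌊u/2⌋ odd]` has fewer than
`2^{6r}` elements or `[⌊u/2⌋ odd] = [⌊u/4⌋ odd]` everywhere (the empty expensive class).  The residual case list after `tm2_levels_exact`,
`tm2_levelTwo_balanced_false` and `tm2_lowrank_false`; NOT a proof of the implication, NOT summit progress. [this work] -/
theorem tm2_second_structure (r : ℕ) (hr : 3 ≤ r) (f g : (Fin ((3 * r + 1) + (3 * r + 1)) → Bool) → Bool) (hf : IsDegLeFun 3 f)
    (hg : IsDegLeFun 3 g) (hΦ : 1 - (1 / 2 : ℝ) ^ (2 * r) ≤ forrelation f g) (hne : forrelation f g ≠ 1) :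
    (∃ u' : (Fin ((3 * r + 1) + (3 * r + 1)) → Bool) → ℤ, (∀ x, W (fun y => signOf (g y)) x = (2 : ℝ) ^ (2 * r + 2) * (u' x : ℝ)) ∧
      2 ^ (6 * r) ≤ #(univ.filter fun x : Fin ((3 * r + 1) + (3 * r + 1)) → Bool => Odd (u' x)) ∧
      #(univ.filter fun x : Fin ((3 * r + 1) + (3 * r + 1)) → Bool => Odd (u' x)) < 2 ^ (6 * r + 1)) ∨
    (∃ v' : (Fin ((3 * r + 1) + (3 * r + 1)) → Bool) → ℤ, (∀ y, W (fun x => signOf (f x)) y = (2 : ℝ) ^ (2 * r + 2) * (v' y : ℝ)) ∧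
      2 ^ (6 * r) ≤ #(univ.filter fun y : Fin ((3 * r + 1) + (3 * r + 1)) → Bool => Odd (v' y)) ∧
      #(univ.filter fun y : Fin ((3 * r + 1) + (3 * r + 1)) → Bool => Odd (v' y)) < 2 ^ (6 * r + 1)) ∨
    (∃ u v : (Fin ((3 * r + 1) + (3 * r + 1)) → Bool) → ℤ, (∀ x, W (fun y => signOf (g y)) x = (2 : ℝ) ^ (2 * r + 1) * (u x : ℝ)) ∧
      (∀ y, W (fun x => signOf (f x)) y = (2 : ℝ) ^ (2 * r + 1) * (v y : ℝ)) ∧ (∀ x, Odd (u x)) ∧ (∀ y, Odd (v y)) ∧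
      (#(univ.filter fun a : Fin ((3 * r + 1) + (3 * r + 1)) → Bool => ∀ b, (decide (Odd (u zeroVec / 2)) ^^ decide (Odd (u a / 2)) ^^
          decide (Odd (u b / 2)) ^^ decide (Odd (u (bxor a b) / 2))) = false) < 2 ^ (6 * r) ∨
        ∀ x, (Odd (u x / 2) ↔ Odd (u x / 2 / 2))) ∧
      (#(univ.filter fun a : Fin ((3 * r + 1) + (3 * r + 1)) → Bool => ∀ b, (decide (Odd (v zeroVec / 2)) ^^ decide (Odd (v a / 2)) ^^
          decide (Odd (v b / 2)) ^^ decide (Odd (v (bxor a b) / 2))) = false) < 2 ^ (6 * r) ∨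
        ∀ y, (Odd (v y / 2) ↔ Odd (v y / 2 / 2)))) := by
  classical
  obtain ⟨ug, hug⟩ := tw_base g hg (2 * r + 1) (by omega)
  obtain ⟨uf, huf⟩ := tw_base f hf (2 * r + 1) (by omega)
  have hΦ' : 1 - (1 / 2 : ℝ) ^ (2 * r) ≤ forrelation g f := by rw [forrelation_comm]; exact hΦ
  have hne' : forrelation g f ≠ 1 := by rw [forrelation_comm]; exact hne
  -- the residual alternative on one type-O side
  have hside : ∀ (f₁ g₁ : (Fin ((3 * r + 1) + (3 * r + 1)) → Bool) → Bool), IsDegLeFun 3 g₁ →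
      1 - (1 / 2 : ℝ) ^ (2 * r) ≤ forrelation f₁ g₁ →
      ∀ u : (Fin ((3 * r + 1) + (3 * r + 1)) → Bool) → ℤ, (∀ x, W (fun y => signOf (g₁ y)) x = (2 : ℝ) ^ (2 * r + 1) * (u x : ℝ)) →
      (∀ x, Odd (u x)) →
      (#(univ.filter fun a : Fin ((3 * r + 1) + (3 * r + 1)) → Bool => ∀ b, (decide (Odd (u zeroVec / 2)) ^^ decide (Odd (u a / 2)) ^^
          decide (Odd (u b / 2)) ^^ decide (Odd (u (bxor a b) / 2))) = false) < 2 ^ (6 * r) ∨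
        ∀ x, (Odd (u x / 2) ↔ Odd (u x / 2 / 2))) := by
    intro f₁ g₁ hg₁ hΦ₁ u hu hodd
    by_contra h
    rw [not_or, not_lt, not_forall] at h
    exact tm2_lowrank_false r hr f₁ g₁ hg₁ u hu hodd h.1 h.2 hΦ₁
  -- an even side is at level `2r+2` (proper); levels `≥ 2r+3` are exact
  have heven : ∀ (f₁ g₁ : (Fin ((3 * r + 1) + (3 * r + 1)) → Bool) → Bool), IsDegLeFun 3 f₁ → IsDegLeFun 3 g₁ →
      1 - (1 / 2 : ℝ) ^ (2 * r) ≤ forrelation f₁ g₁ → forrelation f₁ g₁ ≠ 1 →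
      ∀ u : (Fin ((3 * r + 1) + (3 * r + 1)) → Bool) → ℤ, (∀ x, W (fun y => signOf (g₁ y)) x = (2 : ℝ) ^ (2 * r + 1) * (u x : ℝ)) →
      (∃ x, ¬ Odd (u x)) →
      ∃ u' : (Fin ((3 * r + 1) + (3 * r + 1)) → Bool) → ℤ, (∀ x, W (fun y => signOf (g₁ y)) x = (2 : ℝ) ^ (2 * r + 2) * (u' x : ℝ)) ∧
        2 ^ (6 * r) ≤ #(univ.filter fun x : Fin ((3 * r + 1) + (3 * r + 1)) → Bool => Odd (u' x)) ∧
        #(univ.filter fun x : Fin ((3 * r + 1) + (3 * r + 1)) → Bool => Odd (u' x)) < 2 ^ (6 * r + 1) := by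
    intro f₁ g₁ hf₁ hg₁ hΦ₁ hne₁ u hu ⟨x₀, hx₀⟩
    have hev : ∀ x, ¬ Odd (u x) := fun x h => hx₀ ((tm2_parity_const r g₁ u hg₁ hu x x₀).1 h)
    have hu6 := tw_level_up g₁ u hu hev
    by_cases h6 : ∃ x, Odd (u x / 2)
    · exact ⟨fun x => u x / 2, hu6, tm2_levelTwo_card r (by omega) f₁ g₁ hf₁ hg₁ _ hu6 h6 hΦ₁⟩
    · push Not at h6
      have hu7 := tw_level_up g₁ (fun x => u x / 2) hu6 h6
      exact absurd (tm2_levels_exact r hr f₁ g₁ hf₁ hg₁ _ hu7 hΦ₁) hne₁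
  by_cases hog : ∀ x, Odd (ug x)
  · by_cases hof : ∀ y, Odd (uf y)
    · -- both type O
      right; right
      exact ⟨ug, uf, hug, huf, hog, hof, hside f g hg hΦ ug hug hog, hside g f hf hΦ' uf huf hof⟩
    · push Not at hof
      right; left
      exact heven g f hg hf hΦ' hne' uf huf hof
  · push Not at hog
    left
    exact heven f g hf hg hΦ hne ug hug hog

/-- **Instance `n = 20`** (`r = 3`, threshold `63/64`, at the literal type `Fin 20`): a cubic pair on 20 bits with `63/64 ≤ Φ < 1` has a side at
level 8 with an odd set of size in `[2¹⁸, 2¹⁹)`, or two type-O sides each of first-digit rank `≥ 4` or with `d₁ = d₂` everywhere.  NOT a proof of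
`θ₂₀ < 63/64`; NOT summit progress. [this work] -/
theorem second_boundary_structure_twenty (f g : (Fin 20 → Bool) → Bool) (hf : IsDegLeFun 3 f) (hg : IsDegLeFun 3 g)
    (hΦ : (63 / 64 : ℝ) ≤ forrelation f g) (hne : forrelation f g ≠ 1) :
    (∃ u' : (Fin (10 + 10) → Bool) → ℤ, (∀ x, W (fun y => signOf (g y)) x = (2 : ℝ) ^ 8 * (u' x : ℝ)) ∧
      2 ^ 18 ≤ #(univ.filter fun x : Fin (10 + 10) → Bool => Odd (u' x)) ∧
      #(univ.filter fun x : Fin (10 + 10) → Bool => Odd (u' x)) < 2 ^ 19) ∨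
    (∃ v' : (Fin (10 + 10) → Bool) → ℤ, (∀ y, W (fun x => signOf (f x)) y = (2 : ℝ) ^ 8 * (v' y : ℝ)) ∧
      2 ^ 18 ≤ #(univ.filter fun y : Fin (10 + 10) → Bool => Odd (v' y)) ∧
      #(univ.filter fun y : Fin (10 + 10) → Bool => Odd (v' y)) < 2 ^ 19) ∨
    (∃ u v : (Fin (10 + 10) → Bool) → ℤ, (∀ x, W (fun y => signOf (g y)) x = (2 : ℝ) ^ 7 * (u x : ℝ)) ∧
      (∀ y, W (fun x => signOf (f x)) y = (2 : ℝ) ^ 7 * (v y : ℝ)) ∧ (∀ x, Odd (u x)) ∧ (∀ y, Odd (v y)) ∧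
      (#(univ.filter fun a : Fin (10 + 10) → Bool => ∀ b, (decide (Odd (u zeroVec / 2)) ^^ decide (Odd (u a / 2)) ^^
          decide (Odd (u b / 2)) ^^ decide (Odd (u (bxor a b) / 2))) = false) < 2 ^ 18 ∨
        ∀ x, (Odd (u x / 2) ↔ Odd (u x / 2 / 2))) ∧
      (#(univ.filter fun a : Fin (10 + 10) → Bool => ∀ b, (decide (Odd (v zeroVec / 2)) ^^ decide (Odd (v a / 2)) ^^
          decide (Odd (v b / 2)) ^^ decide (Odd (v (bxor a b) / 2))) = false) < 2 ^ 18 ∨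
        ∀ y, (Odd (v y / 2) ↔ Odd (v y / 2 / 2)))) :=
  tm2_second_structure 3 le_rfl f g hf hg (by norm_num; exact hΦ) hne

/-- **Instance `n = 26`** (`r = 4`, threshold `255/256`, at the literal type `Fin 26`).  NOT a proof of `θ₂₆ < 255/256`; NOT summit progress.
[this work] -/
theorem second_boundary_structure_twentysix (f g : (Fin 26 → Bool) → Bool) (hf : IsDegLeFun 3 f) (hg : IsDegLeFun 3 g)
    (hΦ : (255 / 256 : ℝ) ≤ forrelation f g) (hne : forrelation f g ≠ 1) :
    (∃ u' : (Fin (13 + 13) → Bool) → ℤ, (∀ x, W (fun y => signOf (g y)) x = (2 : ℝ) ^ 10 * (u' x : ℝ)) ∧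
      2 ^ 24 ≤ #(univ.filter fun x : Fin (13 + 13) → Bool => Odd (u' x)) ∧
      #(univ.filter fun x : Fin (13 + 13) → Bool => Odd (u' x)) < 2 ^ 25) ∨
    (∃ v' : (Fin (13 + 13) → Bool) → ℤ, (∀ y, W (fun x => signOf (f x)) y = (2 : ℝ) ^ 10 * (v' y : ℝ)) ∧
      2 ^ 24 ≤ #(univ.filter fun y : Fin (13 + 13) → Bool => Odd (v' y)) ∧
      #(univ.filter fun y : Fin (13 + 13) → Bool => Odd (v' y)) < 2 ^ 25) ∨
    (∃ u v : (Fin (13 + 13) → Bool) → ℤ, (∀ x, W (fun y => signOf (g y)) x = (2 : ℝ) ^ 9 * (u x : ℝ)) ∧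
      (∀ y, W (fun x => signOf (f x)) y = (2 : ℝ) ^ 9 * (v y : ℝ)) ∧ (∀ x, Odd (u x)) ∧ (∀ y, Odd (v y)) ∧
      (#(univ.filter fun a : Fin (13 + 13) → Bool => ∀ b, (decide (Odd (u zeroVec / 2)) ^^ decide (Odd (u a / 2)) ^^
          decide (Odd (u b / 2)) ^^ decide (Odd (u (bxor a b) / 2))) = false) < 2 ^ 24 ∨
        ∀ x, (Odd (u x / 2) ↔ Odd (u x / 2 / 2))) ∧
      (#(univ.filter fun a : Fin (13 + 13) → Bool => ∀ b, (decide (Odd (v zeroVec / 2)) ^^ decide (Odd (v a / 2)) ^^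
          decide (Odd (v b / 2)) ^^ decide (Odd (v (bxor a b) / 2))) = false) < 2 ^ 24 ∨
        ∀ y, (Odd (v y / 2) ↔ Odd (v y / 2 / 2)))) :=
  tm2_second_structure 4 (by norm_num) f g hf hg (by norm_num; exact hΦ) hne

end Summit.QuantumAdvantage.QuantumAdvantage.Theorems.CubicForrelation.NearExactIsExact

end
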